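import Literature.MathematicalPhysics.QuantumFieldTheory.Balaban1983to89.B9RWSums347DefiniteFacesWindow
import Literature.MathematicalPhysics.QuantumFieldTheory.Balaban1983to89.B9SectBStepReadingMaps

/-!
# `Balaban1983to89.B9SectBAllBlocksGeometryY` — THE ALL-BLOCKS [B9] SECT. A GEOMETRY OF A k-LEVEL V1 MEMBER (sites = print's `𝔅 = ⋃_j Λ_j`,
# EVERY block, orphan blocks included), its `β`-pullback = the geometry of record `geo9K`, and [4] Lemma 2.1 (2.60)∕(2.61) + the p. 398 scale
# transfers on it AS THEOREMS (the Sect.-B frames' fields `h261`∕`hST`), from the torus lineage WITHOUT the `β`-pullback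

T. Bałaban, *Propagators for lattice gauge theories in a background field*, Commun. Math. Phys. **99** (1985) 389–434
[`Balaban1985BackgroundPropagators`, "B9"], p. 397 (*"Here y, y′ ∈ 𝔅 = ⋃_{j=0}^k Λ_j"*), (3.41)–(3.42) p. 397, p. 398 (the remark after (3.47)); T. Bałaban,
*Propagators and renormalization transformations for lattice gauge theories. II*, Commun. Math. Phys. **96** (1984) 223–250 [`Balaban1984PropagatorsII`,
"[4]"], (2.1)–(2.4) p. 224, (2.45)–(2.46) p. 231, (2.54) p. 233, (2.59) p. 233, Lemma 2.1 (2.60)–(2.61) p. 234.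

statement-level skeleton of published theorems with citation tags; proofs where landed; nothing here is a claim about the
Yang–Mills mass gap

THE POINT (cell `pub-ymgap`, Track A node N06 [B9], row 13 = the Sect.-B step; seat `pub-ymgap-dag-n06-c` gen 10, LOCATED-8∕8b, PLAN (γ′)).  The geometry of
record `B9GeoNormsKLevelV1.geo9K i` indexes (3.42)–(3.48) by the INDEX BONDS of [4] (2.3) and localises at the carrier block `β b`; at a member with an inner
corner `β` is not onto `𝔅` (node00-def-Y `Node00.MemberYCornered`), so the row-13 hypothesis never reads `G′(U)` at an orphan block.  Print reads `y, y′ ∈ 𝔅`.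
THIS FILE types the ALL-BLOCKS reading geometry and proves on it what the Sect.-B frames (`B9SectBGpStepAtLettersV2.GpFrame₂` v2.1 &c.) consume:
* §1 `geoBK i : B9.Geometry` — sites `𝔅` (`↥(bset i.D.toDomains)` = `Node00.BlkY i`), `scale s = j(s)`, `dist = d_T` (2.46) of the torus, every site-free
  field (`η = |c_f|⁻¹`, `L`, `M = L·M_h`, the argument ∕ cut-off types and norms, (3.41)) THAT OF `geo9K i` (node00's `kGeoU i`), the localisations `suppIn ∕ cutIn`
  read at the block itself (`geoTP` ∕ `kGeoG`, N03's all-blocks readings); `geoBY x := geoBK x.toKIdx` at def-Y's members;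
* §2 ★ `geo9K i` IS the pull-back of `geoBK i` along `β` up to the `scale` field: `dist`, `suppIn`, `suppInT`, `cutIn`, `cutInT`, every norm by `rfl`
  (`comapGeo_geoBK_*`), the scale by [4] (2.3) (`beta_level`: `lvl b = j(β b)`) — hence `len_beta : (geo9K i).len b = (geoBK i).len (β b)`;
* §3 the distance axioms and positivity (`distOK_geoBK`), §4 (2.60) in geometric form (`levelGap_geoBK`, `ineq260_geoBK`), §5 (2.61) at every rate under an
  M-threshold (`rowSum261_geoBK` — the torus statement `B6Lemma21ParamKLevelTorus.lemma21Param_kLevelTorusP` ITSELF, no pull-back, constant `c₁(½)`);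
* §6 at the members: the rate-window packages of n06-k's `B9RWSums347DefiniteFacesWindow` (generic in the family) AT `geoBY`: `ineq261With_window_geoBY`,
  `ineq261_window_geoBY`, `ineq261_fn_geoBY`, `lemma21Window_geoBY`, the scale transfers `transferL_geoBK`, `scaleTransfer_rpow(_window)_geoBY`,
  ★★ `scaleTransfer6_window_geoBY`, ★★ `lemma21Fields_window_geoBY`, and the frames' v2.1 fields ★★ `h261_frameV21_geoBY`, ★★ `hST_frameV21_geoBY`.
So the Sect.-B chain can be run OVER PRINT'S `𝔅` with the identity labelling (no section `ιB`, no corner-free restriction), its input taken from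
the engine's fibre-level majorants (PLAN (γ′) (c2)) and its output restricted to the record along `β` (§2 + `B9SectBStepReadingMaps`).

HONEST SCOPE.  A definition and geometry bookkeeping over N03's torus lineage; the constants are the lineage's α-dependent O(1)'s, not print's `c₁(α)`;
nothing of [B9] asserted; COUNT-NEUTRAL; N06 NOT discharged; one finite lattice programme — nothing continuum, nothing about OS positivity or the mass gap.
-/

noncomputable section

namespace Literature.MathematicalPhysics.QuantumFieldTheory.Balaban1983to89.B9SectBAllBlocksGeometryY

open Finset B6RandomWalk B9Thm34Ext B9RowSum261Faces B9RowSum261DefiniteFaces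
open B6Lemma21Repaired B9Ineq349Whole B9PinMembersKLevelV1 B9GeoLemma21KLevelV1 B9RWSums347DefiniteFacesWindow
open B6SectAOperatorsV1 (BondIdx)
open B6GlobalChartV1 (PV domT)
open B6Geom246MultiLevelBox (bset blkOf)
open B6Geom246MultiLevelTorus (geomT bondT connectedT levelGapT triangle_refl_nonneg_T)
open B6Geometry (levelGap_dist_real)
open B6Ineq2142KLevelV1 (lvl β beta_level)
open B6KLevelCensusIndexV1 (KIdx kGeoG)
open B6Prop22KLevelTorusCensusEta (geoTP)
open B6Lemma21ParamKLevelTorus (lemma21Param_kLevelTorusP)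
open B6Lemma21OneScaleTorus (exists_cond259)
open Node00 (toKT kGeoU)
open B9GeoNormsKLevelV1 (geo9K wNormU)
open B9SectBStepReadingMaps (comapGeo)
open B9Ineq347 (ScaleTransfer)
open B6Cor28 (TransferL transfer_of_260)

variable {d ℓ : ℕ} {hd : 1 ≤ d + 1} {hL : Odd (ℓ + 1) ∧ 1 < ℓ + 1} {b₀ b₁ : ℝ}

/-! ## §1 The all-blocks geometry of a member -/

/-- ★ **THE ALL-BLOCKS [B9] SECT. A GEOMETRY OF A k-LEVEL V1 MEMBER**: sites = the blocks `𝔅 = ⋃_j Λ_j` of the member's torus (every block, the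
orphan blocks of an inner corner included), `scale s = j(s)`, `dist = d_T` ((2.46), the realised torus distance of N03's `geomT`); the localisations
read AT THE BLOCK: `suppIn (.inl f) s` = «supp f ⊂ Δ(s)» (N03's all-blocks site reading `geoTP`), `suppIn (.inr J) s` = «supp J ⊂ Δ(s)» on the fine bonds
(`kGeoG`), `cutIn` likewise; every site-free field (`k`, `η = |c_f|⁻¹`, `L`, `M = L·M_h`, the argument ∕ cut-off types, the norms, the weighted norm (3.41))
is THAT OF the geometry of record `geo9K i` — so that `geo9K i` is the pull-back of this geometry along the carrier-block map `β` (§2).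
[cite: Balaban1985BackgroundPropagators, p.397 («y, y′ ∈ 𝔅 = ⋃_j Λ_j»), (3.39)–(3.42) p.397; Balaban1984PropagatorsII, (2.3)–(2.4) p.224, (2.45)–(2.46) p.231] -/
def geoBK (i : KIdx d ℓ hd hL b₀ b₁) : B9.Geometry where
  Site := ↥(bset i.D.toDomains)
  scale := fun s => s.1.1
  dist := fun s t => (geomT i.D).dist s t
  k := (kGeoU i).k
  eta := (kGeoU i).eta
  L := (kGeoU i).L
  M := (kGeoU i).M
  Loc := (kGeoU i).Loc
  suppIn := fun lam s => match lam with
    | .inl f => (geoTP (toKT i)).suppIn f s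
    | .inr J => (kGeoG i).suppIn J s
  suppInT := fun lam s => match lam with
    | .inl f => (geoTP (toKT i)).suppIn f s
    | .inr J => (kGeoG i).suppIn J s
  supNorm := (kGeoU i).supNorm
  l2Norm := (kGeoU i).l2Norm
  wNorm := wNormU i
  holder := (kGeoU i).holder
  Cut := (kGeoU i).Cut
  cutIn := fun ζ s => match ζ with
    | .inl z => (geoTP (toKT i)).cutIn z s
    | .inr z => (kGeoG i).cutIn z s
  cutInT := fun ζ s => match ζ with
    | .inl z => (geoTP (toKT i)).cutIn z s
    | .inr z => (kGeoG i).cutIn z s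
  cutH := (kGeoU i).cutH
  cutSup := (kGeoU i).cutSup
  suppInT_of_suppIn := fun _ _ h => h
  cutInT_of_cutIn := fun _ _ h => h

variable {Mstar : ℕ} in
/-- the all-blocks geometry at def-Y's members. [cite: Balaban1985BackgroundPropagators, p.397 («y, y′ ∈ 𝔅»), dictionary] -/
def geoBY (x : MemberY d ℓ hd hL b₀ b₁ Mstar) : B9.Geometry := geoBK x.toKIdx

section OneMember

variable (i : KIdx d ℓ hd hL b₀ b₁)

/-- the sites ARE the blocks `𝔅` (node00's `BlkY i`). [cite: Balaban1984PropagatorsII, (2.45) p.231, dictionary] -/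
theorem geoBK_Site : (geoBK i).Site = ↥(bset i.D.toDomains) := rfl

/-- `d(s, t)` is the torus graph distance (2.46), cast to `ℝ`. [cite: Balaban1984PropagatorsII, (2.45)–(2.46) p.231] -/
theorem geoBK_dist_eq (s t : (geoBK i).Site) : (geoBK i).dist s t = (((bondT i.D).dist s t : ℕ) : ℝ) := rfl

/-- `scale s = j(s)`, the level of the block. [cite: Balaban1984PropagatorsII, (2.45) p.231, dictionary] -/
theorem geoBK_scale (s : (geoBK i).Site) : (geoBK i).scale s = s.1.1 := rfl

/-- the `M`-field is that of the geometry of record. [cite: Balaban1984PropagatorsII, (2.1)–(2.2) p.224, dictionary] -/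
theorem geoBK_M : (geoBK i).M = (geo9K i).M := rfl

/-- `M = L·M_h`. [cite: Balaban1984PropagatorsII, (2.1)–(2.2) p.224, dictionary] -/
theorem geoBK_M_eq : (geoBK i).M = (((ℓ + 1 : ℕ) : ℝ)) * (i.Mh : ℝ) := rfl

/-- `L = ℓ + 1`. [cite: Balaban1984PropagatorsII, (2.1) p.224, dictionary] -/
theorem geoBK_L : (geoBK i).L = (((ℓ + 1 : ℕ) : ℝ)) := rfl

/-- `η = |c_f|⁻¹`. [cite: Balaban1984PropagatorsII, (2.1) p.224 («η = L^{−k}»), dictionary] -/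
theorem geoBK_eta : (geoBK i).eta = |i.cf|⁻¹ := rfl

/-- `(L^{scale}η)(s) = L^{j(s)}·|c_f|⁻¹`. [cite: Balaban1985BackgroundPropagators, (3.41) p.397 («Lʲη»), dictionary] -/
theorem geoBK_len (s : (geoBK i).Site) : (geoBK i).len s = (((ℓ + 1 : ℕ) : ℝ)) ^ s.1.1 * |i.cf|⁻¹ := rfl

/-! ## §2 The geometry of record is the pull-back along `β` (up to the printed identity `lvl b = j(β b)`) -/

/-- **the distance of the record IS the all-blocks distance at the carrier blocks** (`rfl`). [cite: Balaban1984PropagatorsII, (2.46) p.231, dictionary] -/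
theorem dist_beta (b b' : (geo9K i).Site) : (geo9K i).dist b b' = (geoBK i).dist (β i.hN i.D i.hk b) (β i.hN i.D i.hk b') := rfl

/-- **the scale of the record IS the level of the carrier block** ([4] (2.3): the carrier of a `Λ_j`-bond is a `j`-block).
[cite: Balaban1984PropagatorsII, (2.3) p.224, (2.45) p.231] -/
theorem scale_beta (b : (geo9K i).Site) : (geo9K i).scale b = (geoBK i).scale (β i.hN i.D i.hk b) := by
  show lvl i.hN i.D i.hk b = (β i.hN i.D i.hk b).1.1
  exact (beta_level i.hN i.D i.hk (one_le_k i) b).symm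

/-- ★ **`(Lʲη)(b) = (Lʲη)(β b)`** — the (3.42) prefactors of the record are those of the all-blocks reading at the carrier block.
[cite: Balaban1985BackgroundPropagators, (3.41)–(3.42) p.397; Balaban1984PropagatorsII, (2.3) p.224] -/
theorem len_beta (b : (geo9K i).Site) : (geo9K i).len b = (geoBK i).len (β i.hN i.D i.hk b) := by
  show (geo9K i).L ^ (geo9K i).scale b * (geo9K i).eta = (geoBK i).L ^ (geoBK i).scale (β i.hN i.D i.hk b) * (geoBK i).eta
  rw [scale_beta]
  rfl

/-- `supp λ ⊂ Δ(β c)` read by the record IS the all-blocks localisation at `β c` (`Iff.rfl`). [cite: Balaban1985BackgroundPropagators, (3.42) p.397 («supp λ ⊂ Δ(y′)»), dictionary] -/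
theorem suppIn_beta (lam : (geo9K i).Loc) (c : (geo9K i).Site) : (geo9K i).suppIn lam c ↔ (geoBK i).suppIn lam (β i.hN i.D i.hk c) := by
  cases lam <;> exact Iff.rfl

/-- the (Δ̃-)argument predicate of the record IS the all-blocks one at `β c`. [cite: Balaban1985BackgroundPropagators, p.397 (Δ̃), dictionary] -/
theorem suppInT_beta (lam : (geo9K i).Loc) (c : (geo9K i).Site) : (geo9K i).suppInT lam c ↔ (geoBK i).suppInT lam (β i.hN i.D i.hk c) := by
  cases lam <;> exact Iff.rfl

/-- the cut-off localisation of the record IS the all-blocks one at `β c`. [cite: Balaban1985BackgroundPropagators, (3.43) p.398 («ζ ∈ C₀^∞(Δ̃(y))»), dictionary] -/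
theorem cutIn_beta (ζ : (geo9K i).Cut) (c : (geo9K i).Site) : (geo9K i).cutIn ζ c ↔ (geoBK i).cutIn ζ (β i.hN i.D i.hk c) := by
  cases ζ <;> exact Iff.rfl

/-- the enlarged cut-off localisation likewise. [cite: Balaban1985BackgroundPropagators, (3.43) p.398, dictionary] -/
theorem cutInT_beta (ζ : (geo9K i).Cut) (c : (geo9K i).Site) : (geo9K i).cutInT ζ c ↔ (geoBK i).cutInT ζ (β i.hN i.D i.hk c) := by
  cases ζ <;> exact Iff.rfl

/-- ★ **THE PULL-BACK OF THE ALL-BLOCKS GEOMETRY ALONG `β` HAS THE RECORD'S DISTANCE** (`rfl`). [cite: Balaban1984PropagatorsII, (2.46) p.231, dictionary] -/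
theorem comapGeo_geoBK_dist : (comapGeo (geoBK i) (β i.hN i.D i.hk)).dist = (geo9K i).dist := rfl

/-- … the record's `M`, `L`, `η`, `k` (`rfl`). [cite: Balaban1984PropagatorsII, (2.1)–(2.2) p.224, dictionary] -/
theorem comapGeo_geoBK_consts :
    (comapGeo (geoBK i) (β i.hN i.D i.hk)).M = (geo9K i).M ∧ (comapGeo (geoBK i) (β i.hN i.D i.hk)).L = (geo9K i).L ∧
      (comapGeo (geoBK i) (β i.hN i.D i.hk)).eta = (geo9K i).eta ∧ (comapGeo (geoBK i) (β i.hN i.D i.hk)).k = (geo9K i).k :=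
  ⟨rfl, rfl, rfl, rfl⟩

/-- … and the record's scale lengths (through `beta_level`). [cite: Balaban1985BackgroundPropagators, (3.41) p.397; Balaban1984PropagatorsII, (2.3) p.224] -/
theorem comapGeo_geoBK_len (b : (geo9K i).Site) : (comapGeo (geoBK i) (β i.hN i.D i.hk)).len b = (geo9K i).len b :=
  (len_beta i b).symm

/-! ## §3 The distance axioms (2.46)∕(2.54) and positivity on the all-blocks geometry -/

/-- `d(s, t) = d(t, s)`. [cite: Balaban1984PropagatorsII, (2.46) p.231 (a graph distance is symmetric)] -/
theorem geoBK_dist_comm (s t : (geoBK i).Site) : (geoBK i).dist s t = (geoBK i).dist t s := by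
  rw [geoBK_dist_eq, geoBK_dist_eq, SimpleGraph.dist_comm]

/-- `d(s, s) = 0`. [cite: Balaban1984PropagatorsII, (2.46) p.231, bookkeeping] -/
theorem geoBK_dist_self (s : (geoBK i).Site) : (geoBK i).dist s s = 0 := by
  rw [geoBK_dist_eq, SimpleGraph.dist_self, Nat.cast_zero]

/-- **(2.54)** `d(s, u) ≤ d(s, t) + d(t, u)` on `𝔅`. [cite: Balaban1984PropagatorsII, (2.54) p.233] -/
theorem geoBK_dist_triangle (s t u : (geoBK i).Site) : (geoBK i).dist s u ≤ (geoBK i).dist s t + (geoBK i).dist t u :=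
  (triangle_refl_nonneg_T i.D (one_le_Mh i) (one_le_P i)).1 s t u

/-- `0 ≤ d(s, t)`. [cite: Balaban1984PropagatorsII, (2.46) p.231, bookkeeping] -/
theorem geoBK_dist_nonneg (s t : (geoBK i).Site) : 0 ≤ (geoBK i).dist s t := by
  rw [geoBK_dist_eq]; exact Nat.cast_nonneg _

/-- `1 ≤ L`. [cite: Balaban1984PropagatorsII, (2.1) p.224, bookkeeping] -/
theorem geoBK_one_le_L : 1 ≤ (geoBK i).L := geo9K_one_le_L i

/-- `0 < η`. [cite: Balaban1984PropagatorsII, (2.1) p.224, bookkeeping] -/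
theorem geoBK_eta_pos : 0 < (geoBK i).eta := geo9K_eta_pos i

/-- `0 ≤ M`. [cite: Balaban1984PropagatorsII, (2.1)–(2.2) p.224, bookkeeping] -/
theorem geoBK_M_nonneg : 0 ≤ (geoBK i).M := geo9K_M_nonneg i

/-- `0 < Lʲη` at every block. [cite: Balaban1985BackgroundPropagators, (3.41) p.397, bookkeeping] -/
theorem geoBK_len_pos (s : (geoBK i).Site) : 0 < (geoBK i).len s := by
  show 0 < (geoBK i).L ^ (geoBK i).scale s * (geoBK i).eta
  exact mul_pos (pow_pos (lt_of_lt_of_le one_pos (geoBK_one_le_L i)) _) (geoBK_eta_pos i)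

/-- `Lʲη = L^{(j : ℝ)}·η` as a real power. [cite: Balaban1985BackgroundPropagators, (3.41) p.397, bookkeeping] -/
theorem geoBK_len_eq_rpow (s : (geoBK i).Site) : (geoBK i).len s = (geoBK i).L ^ ((geoBK i).scale s : ℝ) * (geoBK i).eta := by
  rw [Real.rpow_natCast]; rfl

/-- ★ **`DistOK (geoBK i)`**: `1 ≤ L`, `0 < η`, (2.46) symmetric, (2.54). [cite: Balaban1984PropagatorsII, (2.46) p.231 + (2.54) p.233] -/
theorem distOK_geoBK : DistOK (geoBK i) :=
  ⟨geoBK_one_le_L i, geoBK_eta_pos i, geoBK_dist_comm i, geoBK_dist_triangle i⟩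

end OneMember

/-! ## §4 (2.60) in geometric form on the all-blocks family: `d(s, t) ≥ R₀·M·max(|j(s) − j(t)| − 1, 0)` for `R₀ ≤ 2L² − 1` -/

section LevelGapSec

/-- ★ **[4] (2.60) IN ITS GEOMETRIC FORM ON `𝔅`**: for every `R₀ ≤ 2L² − 1` (so `R₀ ≤ R − 1` at every member),
`R₀·M·max(|j(s) − j(t)| − 1, 0) ≤ d(s, t)` for ALL blocks `s, t` — the walk form of (2.2) on the torus (`levelGapT`) through
`levelGap_dist_real`; no carrier map. [cite: Balaban1984PropagatorsII, Lemma 2.1 (2.60) p.234, (2.57) p.233, (2.2) p.224] -/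
theorem levelGap_geoBK {R₀ : ℝ} (hR₀ : R₀ ≤ 2 * ((ℓ : ℝ) + 1) ^ 2 - 1) :
    LevelGap (geoBK (d := d) (ℓ := ℓ) (hd := hd) (hL := hL) (b₀ := b₀) (b₁ := b₁)) R₀ := by
  intro i s t
  have hMh := one_le_Mh i
  have hP := one_le_P i
  have hd : (((i.R * ((ℓ + 1) * i.Mh) - 1 : ℕ) : ℝ)) * max (|((s.1.1 : ℕ) : ℝ) - ((t.1.1 : ℕ) : ℝ)| - 1) 0 ≤
      (((bondT i.D).dist s t : ℕ) : ℝ) :=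
    levelGap_dist_real (connectedT (D := i.D) hMh hP) (levelGapT i.D) _ _
  show R₀ * ((((ℓ + 1 : ℕ) : ℝ)) * (i.Mh : ℝ)) * max (|((s.1.1 : ℕ) : ℝ) - ((t.1.1 : ℕ) : ℝ)| - 1) 0 ≤ (((bondT i.D).dist s t : ℕ) : ℝ)
  refine le_trans (mul_le_mul_of_nonneg_right ?_ (le_max_right _ _)) hd
  have hR : 2 * ((ℓ : ℝ) + 1) ^ 2 ≤ (i.R : ℝ) := by exact_mod_cast i.hR2
  have hM1 : (1 : ℝ) ≤ (i.Mh : ℝ) := by exact_mod_cast hMh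
  have hℓ0 : (0 : ℝ) ≤ (ℓ : ℝ) := Nat.cast_nonneg ℓ
  have hR1 : 1 ≤ i.R := le_trans (Nat.succ_le_of_lt (by positivity)) i.hR2
  have h1 : 1 ≤ i.R * ((ℓ + 1) * i.Mh) :=
    Nat.one_le_iff_ne_zero.mpr (Nat.mul_ne_zero (by omega) (Nat.mul_ne_zero (by omega) (by omega)))
  rw [Nat.cast_sub h1]
  push_cast
  nlinarith [mul_nonneg (show (0 : ℝ) ≤ (i.R : ℝ) - 1 - R₀ by nlinarith) (show (0 : ℝ) ≤ ((ℓ : ℝ) + 1) * (i.Mh : ℝ) by positivity),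
    mul_le_mul hM1 (show (1 : ℝ) ≤ (ℓ : ℝ) + 1 by linarith) zero_le_one (by positivity)]

/-- (2.60) in geometric form with `R₀ = 1`. [cite: Balaban1984PropagatorsII, Lemma 2.1 (2.60) p.234] -/
theorem levelGap_geoBK_one : LevelGap (geoBK (d := d) (ℓ := ℓ) (hd := hd) (hL := hL) (b₀ := b₀) (b₁ := b₁)) 1 :=
  levelGap_geoBK (by nlinarith [(Nat.cast_nonneg ℓ : (0 : ℝ) ≤ ℓ)])

/-- **(2.60) IN ITS EXPONENTIAL FORM ON `𝔅`, AT EVERY RATE `ε ≥ 0`**, `RM` read as `(2L² − 1)·M`. [cite: Balaban1984PropagatorsII, Lemma 2.1 (2.60) p.234] -/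
theorem ineq260_geoBK (i : KIdx d ℓ hd hL b₀ b₁) {ε : ℝ} (hε : 0 ≤ ε) (s t : (geoBK i).Site) :
    Real.exp (-(ε * (geoBK i).dist s t)) ≤
      Real.exp (-(ε * (2 * ((ℓ : ℝ) + 1) ^ 2 - 1) * (geoBK i).M * max (|((geoBK i).scale s : ℝ) - ((geoBK i).scale t : ℝ)| - 1) 0)) := by
  have h := levelGap_geoBK (d := d) (ℓ := ℓ) (hd := hd) (hL := hL) (b₀ := b₀) (b₁ := b₁) le_rfl i s t
  rw [Real.exp_le_exp, neg_le_neg_iff]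
  calc ε * (2 * ((ℓ : ℝ) + 1) ^ 2 - 1) * (geoBK i).M * max (|((geoBK i).scale s : ℝ) - ((geoBK i).scale t : ℝ)| - 1) 0
      = ε * ((2 * ((ℓ : ℝ) + 1) ^ 2 - 1) * (geoBK i).M * max (|((geoBK i).scale s : ℝ) - ((geoBK i).scale t : ℝ)| - 1) 0) := by ring
    _ ≤ ε * (geoBK i).dist s t := mul_le_mul_of_nonneg_left h hε

end LevelGapSec

/-! ## §5 (2.61) at every rate under an M-threshold: the row sums over ALL blocks (the torus statement itself) -/

section RowSumSec

/-- ★ **[4] (2.61) AT EVERY RATE UNDER AN M-THRESHOLD, OVER ALL BLOCKS OF THE TORUS** (core form, the `Fintype` instance on the sites a binder): for every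
`κ > 0` there are `M_L` and `C` such that every member with `M_L ≤ M = L·M_h` has `Σ_{t∈𝔅} e^{−κd(s,t)} ≤ C` for every block `s` — the torus Lemma 2.1
`lemma21Param_kLevelTorusP` at the rate pair `(δ₀, ½)`, `δ₀ = min(κ, 2∕L)`, on print's (2.59) for `(R − 1)·M` (`exists_cond259`), then rate monotonicity;
NO pull-back (every block is a site). [cite: Balaban1984PropagatorsII, Lemma 2.1 (2.61) p.234 + (2.59) p.233] -/
theorem rowSum_geoBK_core {κ : ℝ} (hκ : 0 < κ) :
    ∃ ML C : ℝ, ∀ (i : KIdx d ℓ hd hL b₀ b₁) [Fintype (geoBK i).Site], ML ≤ (geoBK i).M →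
      ∀ s : (geoBK i).Site, ∑ t, Real.exp (-(κ * (geoBK i).dist s t)) ≤ C := by
  classical
  have hℓ1 : 1 ≤ ℓ := by have := hL.2; omega
  have hL0 : (0 : ℝ) < (ℓ : ℝ) + 1 := by positivity
  set δ₀ : ℝ := min κ (2 / ((ℓ : ℝ) + 1)) with hδ₀_def
  have hδ₀ : 0 < δ₀ := lt_min hκ (div_pos two_pos hL0)
  have hδL : δ₀ ≤ 2 / ((ℓ : ℝ) + 1) := min_le_right _ _
  have hδκ : δ₀ ≤ κ := min_le_left _ _
  have hα0 : (0 : ℝ) < 1 / 2 := by norm_num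
  have hα1 : (1 / 2 : ℝ) < 1 := by norm_num
  have hαδ : 0 < 1 / 2 * δ₀ := by positivity
  obtain ⟨c₁, -, h21⟩ := lemma21Param_kLevelTorusP d ℓ hℓ1 hδ₀ hδL
  obtain ⟨R₁, hR₁⟩ := exists_cond259 (d + 1) hαδ
  refine ⟨(R₁ : ℝ), c₁ (1 / 2), fun i inst hM s => ?_⟩
  obtain rfl : inst = (inferInstance : Fintype ↥(bset i.D.toDomains)) := Subsingleton.elim _ _
  have hMh := one_le_Mh i
  have hR1 : (1 : ℝ) ≤ (i.R : ℝ) - 1 := by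
    have h : 2 * ((ℓ : ℝ) + 1) ^ 2 ≤ (i.R : ℝ) := by exact_mod_cast i.hR2
    nlinarith [(Nat.cast_nonneg ℓ : (0 : ℝ) ≤ ℓ)]
  have hMeq : (geoBK i).M = ((ℓ : ℝ) + 1) * (i.Mh : ℝ) := by rw [geoBK_M_eq]; push_cast; ring
  have hM' : (R₁ : ℝ) ≤ ((ℓ : ℝ) + 1) * (i.Mh : ℝ) := hMeq ▸ hM
  have hM0 : (0 : ℝ) ≤ ((ℓ : ℝ) + 1) * (i.Mh : ℝ) := by positivity
  have h259 : B6.Cond259 (d + 1) δ₀ (1 / 2) ((geoTP (toKT i)).R - 1) (geoTP (toKT i)).M := by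
    show B6.Cond259 (d + 1) δ₀ (1 / 2) ((i.R : ℝ) - 1) (((ℓ : ℝ) + 1) * (i.Mh : ℝ))
    have h1 := hR₁ 1 le_rfl
    unfold B6.Cond259 at h1 ⊢
    rw [Nat.cast_one, mul_one] at h1
    refine lt_of_lt_of_le h1 ?_
    have hRM : (R₁ : ℝ) ≤ ((i.R : ℝ) - 1) * (((ℓ : ℝ) + 1) * (i.Mh : ℝ)) :=
      le_trans hM' (le_mul_of_one_le_left hM0 hR1)
    calc 1 / 4 * (1 / 2) * δ₀ * (R₁ : ℝ) = (1 / 4 * (1 / 2) * δ₀) * (R₁ : ℝ) := by ring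
      _ ≤ (1 / 4 * (1 / 2) * δ₀) * (((i.R : ℝ) - 1) * (((ℓ : ℝ) + 1) * (i.Mh : ℝ))) :=
          mul_le_mul_of_nonneg_left hRM (by positivity)
      _ = 1 / 4 * (1 / 2) * δ₀ * ((i.R : ℝ) - 1) * (((ℓ : ℝ) + 1) * (i.Mh : ℝ)) := by ring
  obtain ⟨-, h261⟩ := h21 (toKT i) trivial (1 / 2) hα0 hα1 h259
  -- (2.61) on the blocks of the torus at the rate ½δ₀, then rate monotonicity ½δ₀ ≤ κ
  have hrow : ∑ t : (geoTP (toKT i)).Site, Real.exp (-(1 / 2 * δ₀ * (geoTP (toKT i)).dist s t)) ≤ c₁ (1 / 2) := h261 s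
  have hrate : (1 / 2 : ℝ) * δ₀ ≤ κ := by linarith
  refine le_trans (Finset.sum_le_sum fun t _ => ?_) hrow
  have hdist : 0 ≤ (geoTP (toKT i)).dist s t := Nat.cast_nonneg _
  exact Real.exp_le_exp.mpr (neg_le_neg (mul_le_mul_of_nonneg_right hrate hdist))

/-- ★ **`RowSum261 geoBK`** — [4] (2.61) with a generic constant, at every rate, under an M-threshold, on the all-blocks family (any `Fintype` instance on the
sites). [cite: Balaban1984PropagatorsII, Lemma 2.1 (2.61) p.234 + (2.59) p.233] -/
theorem rowSum261_geoBK [inst : ∀ i : KIdx d ℓ hd hL b₀ b₁, Fintype (geoBK i).Site] :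
    RowSum261 (geoBK (d := d) (ℓ := ℓ) (hd := hd) (hL := hL) (b₀ := b₀) (b₁ := b₁)) := by
  intro κ hκ
  obtain ⟨ML, C, h⟩ := rowSum_geoBK_core (d := d) (ℓ := ℓ) (hd := hd) (hL := hL) (b₀ := b₀) (b₁ := b₁) hκ
  exact ⟨ML, C, fun i hM s => @h i (inst i) hM s⟩

end RowSumSec

/-! ## §6 At def-Y's members `geoBY x`: the record-geometry binders, the rate windows, the scale transfers, the frames' Lemma-2.1 fields -/

section Members

variable {Mstar : ℕ}

/-- ★ `DistOK (geoBY x)`. [cite: Balaban1984PropagatorsII, (2.46) p.231 + (2.54) p.233] -/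
theorem distOK_geoBY (x : MemberY d ℓ hd hL b₀ b₁ Mstar) : DistOK (geoBY x) := distOK_geoBK x.toKIdx

/-- `0 ≤ d` at a member. [cite: Balaban1984PropagatorsII, (2.46) p.231, bookkeeping] -/
theorem geoBY_dist_nonneg (x : MemberY d ℓ hd hL b₀ b₁ Mstar) (s t : (geoBY x).Site) : 0 ≤ (geoBY x).dist s t :=
  geoBK_dist_nonneg x.toKIdx s t

/-- `d` symmetric at a member. [cite: Balaban1984PropagatorsII, (2.46) p.231, bookkeeping] -/
theorem geoBY_dist_comm (x : MemberY d ℓ hd hL b₀ b₁ Mstar) (s t : (geoBY x).Site) : (geoBY x).dist s t = (geoBY x).dist t s :=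
  geoBK_dist_comm x.toKIdx s t

/-- `d(s, s) = 0` at a member. [cite: Balaban1984PropagatorsII, (2.46) p.231, bookkeeping] -/
theorem geoBY_dist_self (x : MemberY d ℓ hd hL b₀ b₁ Mstar) (s : (geoBY x).Site) : (geoBY x).dist s s = 0 := geoBK_dist_self x.toKIdx s

/-- (2.54) at a member. [cite: Balaban1984PropagatorsII, (2.54) p.233] -/
theorem geoBY_dist_triangle (x : MemberY d ℓ hd hL b₀ b₁ Mstar) (s t u : (geoBY x).Site) :
    (geoBY x).dist s u ≤ (geoBY x).dist s t + (geoBY x).dist t u :=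
  geoBK_dist_triangle x.toKIdx s t u

/-- `0 < Lʲη` at a member. [cite: Balaban1985BackgroundPropagators, (3.41) p.397, bookkeeping] -/
theorem geoBY_len_pos (x : MemberY d ℓ hd hL b₀ b₁ Mstar) (s : (geoBY x).Site) : 0 < (geoBY x).len s := geoBK_len_pos x.toKIdx s

/-- `L = ℓ + 1` at a member (as a natural-number cast). [cite: Balaban1984PropagatorsII, (2.1) p.224, dictionary] -/
theorem geoBY_L (x : MemberY d ℓ hd hL b₀ b₁ Mstar) : (geoBY x).L = (((ℓ + 1 : ℕ) : ℝ)) := rfl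

/-- ★ `LevelGap geoBY R₀` for every `R₀ ≤ 2L² − 1`. [cite: Balaban1984PropagatorsII, Lemma 2.1 (2.60) p.234, (2.2) p.224] -/
theorem levelGap_geoBY {R₀ : ℝ} (hR₀ : R₀ ≤ 2 * ((ℓ : ℝ) + 1) ^ 2 - 1) :
    LevelGap (geoBY (d := d) (ℓ := ℓ) (hd := hd) (hL := hL) (b₀ := b₀) (b₁ := b₁) (Mstar := Mstar)) R₀ :=
  fun x s t => levelGap_geoBK hR₀ x.toKIdx s t

/-- `LevelGap geoBY 1`. [cite: Balaban1984PropagatorsII, Lemma 2.1 (2.60) p.234] -/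
theorem levelGap_geoBY_one : LevelGap (geoBY (d := d) (ℓ := ℓ) (hd := hd) (hL := hL) (b₀ := b₀) (b₁ := b₁) (Mstar := Mstar)) 1 :=
  fun x s t => levelGap_geoBK_one x.toKIdx s t

/-- ★ `RowSum261 geoBY` (any `Fintype` instance on the sites). [cite: Balaban1984PropagatorsII, Lemma 2.1 (2.61) p.234 + (2.59) p.233] -/
theorem rowSum261_geoBY [instY : ∀ x : MemberY d ℓ hd hL b₀ b₁ Mstar, Fintype (geoBY x).Site] :
    RowSum261 (geoBY (d := d) (ℓ := ℓ) (hd := hd) (hL := hL) (b₀ := b₀) (b₁ := b₁) (Mstar := Mstar)) := by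
  intro κ hκ
  obtain ⟨ML, C, h⟩ := rowSum_geoBK_core (d := d) (ℓ := ℓ) (hd := hd) (hL := hL) (b₀ := b₀) (b₁ := b₁) hκ
  exact ⟨ML, C, fun x hM s => @h x.toKIdx (instY x) hM s⟩

/-- **(2.60) THRESHOLD-FREE ON `𝔅`** for every transport letter `R x ≤ 2L² − 1` and rate product `αδ ≥ 0`.
[cite: Balaban1984PropagatorsII, Lemma 2.1 (2.60) p.234 + (2.2) p.224] -/
theorem ineq260_geoBY_all (R : MemberY d ℓ hd hL b₀ b₁ Mstar → ℝ) (hR : ∀ x, R x ≤ 2 * ((ℓ : ℝ) + 1) ^ 2 - 1)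
    (H : MemberY d ℓ hd hL b₀ b₁ Mstar → Prop) [∀ x : MemberY d ℓ hd hL b₀ b₁ Mstar, Fintype (geoBY x).Site] :
    ∀ (x : MemberY d ℓ hd hL b₀ b₁ Mstar) (δ α : ℝ), 0 ≤ α * δ → Ineq260 (toB6 (geoBY x) (R x) (H x)) δ α :=
  fun x _ _ h => ineq260_toB6_of_levelGap (levelGap_geoBY (hR x)) h (H x) x

variable [∀ x : MemberY d ℓ hd hL b₀ b₁ Mstar, Fintype (geoBY x).Site]

/-- ★ (2.61) «antitone in the rate» with the definite constant, on `𝔅`. [cite: Balaban1984PropagatorsII, Lemma 2.1 (2.61) p.234 + (2.59) p.233] -/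
theorem ineq261With_window_geoBY (R : MemberY d ℓ hd hL b₀ b₁ Mstar → ℝ) (H : MemberY d ℓ hd hL b₀ b₁ Mstar → Prop)
    {κlo : ℝ} (hκlo : 0 < κlo) :
    ∃ ML : ℝ, ∀ (x : MemberY d ℓ hd hL b₀ b₁ Mstar) (δ α : ℝ), κlo ≤ α * δ → ML ≤ (geoBY x).M →
      Ineq261With (rowConst261 (@geoBY d ℓ hd hL b₀ b₁ Mstar) κlo) (toB6 (geoBY x) (R x) (H x)) δ α :=
  ineq261With_window_of_rowSum261 _ R H rowSum261_geoBY geoBY_dist_nonneg hκlo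

/-- ★★ (2.61) in printed shape on `𝔅`, one exponent and one threshold per closed-below window.
[cite: Balaban1984PropagatorsII, Lemma 2.1 (2.61) p.234 + (2.59) p.233] -/
theorem ineq261_window_geoBY (R : MemberY d ℓ hd hL b₀ b₁ Mstar → ℝ) (H : MemberY d ℓ hd hL b₀ b₁ Mstar → Prop)
    {δlo δhi αlo : ℝ} (hδlo : 0 < δlo) (hδ : δlo ≤ δhi) (hαlo : 0 < αlo) :
    ∃ (dB : ℕ) (ML : ℝ), ∀ (x : MemberY d ℓ hd hL b₀ b₁ Mstar) (δ α : ℝ), δlo ≤ δ → δ ≤ δhi → αlo ≤ α → α ≤ 1 →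
      ML ≤ (geoBY x).M → Ineq261 dB (toB6 (geoBY x) (R x) (H x)) δ α :=
  ineq261_window_of_rowSum261 _ R H rowSum261_geoBY geoBY_dist_nonneg hδlo hδ hαlo

/-- ★★ (2.61) in printed shape on `𝔅`, exponent and threshold as functions of the rate (the frame-field shape).
[cite: Balaban1984PropagatorsII, Lemma 2.1 (2.61) p.234 + (2.59) p.233] -/
theorem ineq261_fn_geoBY (R : MemberY d ℓ hd hL b₀ b₁ Mstar → ℝ) (H : MemberY d ℓ hd hL b₀ b₁ Mstar → Prop)
    {αlo : ℝ} (hαlo : 0 < αlo) :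
    ∃ (d261 : ℝ → ℕ) (M261 : ℝ → ℝ), ∀ (x : MemberY d ℓ hd hL b₀ b₁ Mstar) (δ α : ℝ), 0 < δ → αlo ≤ α → α ≤ 1 →
      M261 δ ≤ (geoBY x).M → Ineq261 (d261 δ) (toB6 (geoBY x) (R x) (H x)) δ α :=
  ineq261_fn_of_rowSum261 _ R H rowSum261_geoBY geoBY_dist_nonneg hαlo

/-- ★★ [4] Lemma 2.1 on a closed-below rate window on `𝔅`, `R` read as `1`: (2.60) threshold-free and (2.61) with one exponent ∕ threshold.
[cite: Balaban1984PropagatorsII, Lemma 2.1 (2.60)–(2.61) p.234 + (2.59) p.233] -/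
theorem lemma21Window_geoBY (H : MemberY d ℓ hd hL b₀ b₁ Mstar → Prop) {δlo δhi αlo : ℝ} (hδlo : 0 < δlo)
    (hδ : δlo ≤ δhi) (hαlo : 0 < αlo) :
    ∃ (dB : ℕ) (ML : ℝ), ∀ (x : MemberY d ℓ hd hL b₀ b₁ Mstar) (δ α : ℝ), δlo ≤ δ → δ ≤ δhi → αlo ≤ α → α ≤ 1 →
      ML ≤ (geoBY x).M →
        Ineq260 (toB6 (geoBY x) 1 (H x)) δ α ∧ Ineq261 dB (toB6 (geoBY x) 1 (H x)) δ α := by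
  obtain ⟨dB, ML, h⟩ := ineq261_window_geoBY (fun _ => (1 : ℝ)) H hδlo hδ hαlo
  refine ⟨dB, ML, fun x δ α h1 h2 h3 h4 hM => ⟨?_, h x δ α h1 h2 h3 h4 hM⟩⟩
  have hκ : 0 ≤ α * δ := mul_nonneg (hαlo.le.trans h3) (hδlo.le.trans h1)
  exact ineq260_toB6_of_levelGap levelGap_geoBY_one hκ (H x) x

omit [∀ x : MemberY d ℓ hd hL b₀ b₁ Mstar, Fintype (geoBY x).Site] in
/-- **(2.60) ⇒ SCALE TRANSFER ON `𝔅` AT EVERY RATE `ε > 0` AND REAL POWER `q` UNDER AN M-THRESHOLD**: `(L^{j′}η)^q ≤ L^{|q|}·e^{εd(s,t)}·(Lʲη)^q` whenever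
`|q|·log L ≤ ε·(2L² − 1)·M` (`B6Cor28.transfer_of_260` on `ineq260_geoBK`). [cite: Balaban1984PropagatorsII, Lemma 2.1 (2.60) p.234 with (2.88) p.238] -/
theorem transferL_geoBK (i : KIdx d ℓ hd hL b₀ b₁) {ε : ℝ} (hε : 0 < ε) (q : ℝ)
    (hM : |q| * Real.log (geoBK i).L ≤ ε * (2 * ((ℓ : ℝ) + 1) ^ 2 - 1) * (geoBK i).M) :
    TransferL (geoBK i).len (geoBK i).dist ε q ((geoBK i).L ^ |q|) := by
  have hL0 : 0 < (geoBK i).L := lt_of_lt_of_le one_pos (geoBK_one_le_L i)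
  have hlarge : (geoBK i).L ^ |q| ≤ Real.exp (ε * (2 * ((ℓ : ℝ) + 1) ^ 2 - 1) * (geoBK i).M) := by
    rw [Real.rpow_def_of_pos hL0]
    exact Real.exp_le_exp.mpr ((mul_comm (Real.log (geoBK i).L) |q|).le.trans hM)
  have h := (transfer_of_260 (geoBK i).scale (geoBK i).dist (geoBK i).L (geoBK i).eta ε
    (2 * ((ℓ : ℝ) + 1) ^ 2 - 1) (geoBK i).M q (geoBK_one_le_L i) (geoBK_eta_pos i) hlarge (fun s t => ineq260_geoBK i hε.le s t)).2
  rwa [show (fun s => (geoBK i).L ^ ((geoBK i).scale s : ℝ) * (geoBK i).eta) = (geoBK i).len from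
    funext fun s => (geoBK_len_eq_rpow i s).symm] at h

omit [∀ x : MemberY d ℓ hd hL b₀ b₁ Mstar, Fintype (geoBY x).Site] in
/-- p. 398's scale transfer on `𝔅`, every real power, under the located size condition. [cite: Balaban1985BackgroundPropagators, p.398 remark after (3.47); Balaban1984PropagatorsII, Lemma 2.1 (2.60) p.234] -/
theorem scaleTransfer_rpow_geoBY (x : MemberY d ℓ hd hL b₀ b₁ Mstar) {δ α : ℝ} (hε : 0 < α * δ) (q : ℝ)
    (hM : |q| * Real.log (geoBY x).L ≤ α * δ * (2 * ((ℓ : ℝ) + 1) ^ 2 - 1) * (geoBY x).M) :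
    ScaleTransfer (geoBY x) δ α ((geoBY x).L ^ |q|) (fun s => (geoBY x).len s ^ q) := by
  intro s t
  have h := transferL_geoBK x.toKIdx hε q hM s t
  have hE : 0 < Real.exp (α * δ * (geoBY x).dist s t) := Real.exp_pos _
  rw [Real.exp_neg, inv_mul_le_iff₀ hE]
  calc (geoBY x).len t ^ q ≤ (geoBY x).L ^ |q| * Real.exp (α * δ * (geoBY x).dist s t) * (geoBY x).len s ^ q := h
    _ = Real.exp (α * δ * (geoBY x).dist s t) * ((geoBY x).L ^ |q| * (geoBY x).len s ^ q) := by ring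

omit [∀ x : MemberY d ℓ hd hL b₀ b₁ Mstar, Fintype (geoBY x).Site] in
/-- … on a rate window, one threshold and the one constant `(ℓ + 1)⁴` for every power `|q| ≤ 4`.
[cite: Balaban1985BackgroundPropagators, p.398 remark after (3.47); Balaban1984PropagatorsII, Lemma 2.1 (2.60) p.234] -/
theorem scaleTransfer_rpow_window_geoBY {κlo : ℝ} (hκlo : 0 < κlo) {q : ℝ} (hq : |q| ≤ 4)
    (x : MemberY d ℓ hd hL b₀ b₁ Mstar) {δ α : ℝ} (hκ : κlo ≤ α * δ)
    (hM : 4 * Real.log ((ℓ : ℝ) + 1) / κlo ≤ (geoBY x).M) :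
    ScaleTransfer (geoBY x) δ α (((ℓ : ℝ) + 1) ^ 4) (fun s => (geoBY x).len s ^ q) := by
  have hε : 0 < α * δ := lt_of_lt_of_le hκlo hκ
  have hLeq : (geoBY x).L = (ℓ : ℝ) + 1 := by rw [geoBY_L x]; push_cast; ring
  have hL1 : 1 ≤ (geoBY x).L := geoBK_one_le_L x.toKIdx
  have hM0 : 0 ≤ (geoBY x).M := geoBK_M_nonneg x.toKIdx
  have hlog0 : 0 ≤ Real.log ((ℓ : ℝ) + 1) := Real.log_nonneg (by rw [← hLeq]; exact hL1)
  have hR1 : (1 : ℝ) ≤ 2 * ((ℓ : ℝ) + 1) ^ 2 - 1 := by nlinarith [(Nat.cast_nonneg ℓ : (0 : ℝ) ≤ ℓ)]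
  have h4 : 4 * Real.log ((ℓ : ℝ) + 1) ≤ κlo * (geoBY x).M := by
    rw [div_le_iff₀ hκlo] at hM; linarith
  have hsize : |q| * Real.log (geoBY x).L ≤ α * δ * (2 * ((ℓ : ℝ) + 1) ^ 2 - 1) * (geoBY x).M := by
    rw [hLeq]
    calc |q| * Real.log ((ℓ : ℝ) + 1) ≤ 4 * Real.log ((ℓ : ℝ) + 1) := mul_le_mul_of_nonneg_right hq hlog0
      _ ≤ κlo * (geoBY x).M := h4
      _ = κlo * 1 * (geoBY x).M := by ring
      _ ≤ α * δ * (2 * ((ℓ : ℝ) + 1) ^ 2 - 1) * (geoBY x).M :=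
          mul_le_mul_of_nonneg_right (mul_le_mul hκ hR1 zero_le_one hε.le) hM0
  have hT := scaleTransfer_rpow_geoBY x hε q hsize
  have hC : (geoBY x).L ^ |q| ≤ ((ℓ : ℝ) + 1) ^ 4 := by
    rw [hLeq]
    calc ((ℓ : ℝ) + 1) ^ |q| ≤ ((ℓ : ℝ) + 1) ^ (4 : ℝ) :=
          Real.rpow_le_rpow_of_exponent_le (by rw [← hLeq]; exact hL1) hq
      _ = ((ℓ : ℝ) + 1) ^ 4 := by norm_num
  exact scaleTransfer_mono_const (fun s => Real.rpow_nonneg (geoBK_len_pos x.toKIdx s).le _) hC hT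

omit [∀ x : MemberY d ℓ hd hL b₀ b₁ Mstar, Fintype (geoBY x).Site] in
/-- ★★ **THE SIX p. 398 SCALE TRANSFERS OF THE SECT.-B FRAMES ON A RATE WINDOW, OVER `𝔅`** (weights `Lʲη`, `(Lʲη)²`, `(Lʲη)⁻¹`, `(Lʲη)⁻²`, `(Lʲη)⁻⁴`
and `(Lʲη)^{−4}` as a real power), the one constant `(ℓ + 1)⁴`, at every member with `4·log(ℓ + 1)∕κlo ≤ M` and every rate pair with `κlo ≤ αδ`.
[cite: Balaban1985BackgroundPropagators, p.398 remark after (3.47); Balaban1984PropagatorsII, Lemma 2.1 (2.60) p.234] -/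
theorem scaleTransfer6_window_geoBY {κlo : ℝ} (hκlo : 0 < κlo) (x : MemberY d ℓ hd hL b₀ b₁ Mstar) {δ α : ℝ}
    (hκ : κlo ≤ α * δ) (hM : 4 * Real.log ((ℓ : ℝ) + 1) / κlo ≤ (geoBY x).M) :
    ScaleTransfer (geoBY x) δ α (((ℓ : ℝ) + 1) ^ 4) (fun s => (geoBY x).len s) ∧
      ScaleTransfer (geoBY x) δ α (((ℓ : ℝ) + 1) ^ 4) (fun s => (geoBY x).len s ^ 2) ∧
      ScaleTransfer (geoBY x) δ α (((ℓ : ℝ) + 1) ^ 4) (fun s => ((geoBY x).len s)⁻¹) ∧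
      ScaleTransfer (geoBY x) δ α (((ℓ : ℝ) + 1) ^ 4) (fun s => ((geoBY x).len s ^ 2)⁻¹) ∧
      ScaleTransfer (geoBY x) δ α (((ℓ : ℝ) + 1) ^ 4) (fun s => ((geoBY x).len s ^ 4)⁻¹) ∧
      ScaleTransfer (geoBY x) δ α (((ℓ : ℝ) + 1) ^ 4) (fun s => (geoBY x).len s ^ (-(4 : ℝ))) := by
  have hpos : ∀ s, 0 < (geoBY x).len s := fun s => geoBK_len_pos x.toKIdx s
  have T : ∀ q : ℝ, |q| ≤ 4 → ScaleTransfer (geoBY x) δ α (((ℓ : ℝ) + 1) ^ 4) (fun s => (geoBY x).len s ^ q) :=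
    fun q hq => scaleTransfer_rpow_window_geoBY hκlo hq x hκ hM
  refine ⟨?_, ?_, ?_, ?_, ?_, T (-4) (by norm_num)⟩
  · exact scaleTransfer_congr (fun s => Real.rpow_one _) (T 1 (by norm_num))
  · exact scaleTransfer_congr (fun s => by rw [← Real.rpow_natCast]; norm_num) (T 2 (by norm_num))
  · exact scaleTransfer_congr (fun s => Real.rpow_neg_one _) (T (-1) (by norm_num))
  · exact scaleTransfer_congr (fun s => by
      rw [Real.rpow_neg (hpos s).le, ← Real.rpow_natCast]; norm_num) (T (-2) (by norm_num))
  · exact scaleTransfer_congr (fun s => by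
      rw [Real.rpow_neg (hpos s).le, ← Real.rpow_natCast]; norm_num) (T (-4) (by norm_num))

/-- ★★ **BOTH LEMMA-2.1 FRAME FIELDS ON A CLOSED-BELOW RATE WINDOW OVER `𝔅`, ONE THRESHOLD.**
[cite: Balaban1985BackgroundPropagators, p.398 remark after (3.47); Balaban1984PropagatorsII, Lemma 2.1 (2.60)–(2.61) p.234 + (2.59) p.233] -/
theorem lemma21Fields_window_geoBY (R : MemberY d ℓ hd hL b₀ b₁ Mstar → ℝ) (H : MemberY d ℓ hd hL b₀ b₁ Mstar → Prop)
    {δlo δhi αlo : ℝ} (hδlo : 0 < δlo) (hδ : δlo ≤ δhi) (hαlo : 0 < αlo) :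
    ∃ (dB : ℕ) (ML : ℝ), ∀ (x : MemberY d ℓ hd hL b₀ b₁ Mstar) (δ α : ℝ), δlo ≤ δ → δ ≤ δhi → αlo ≤ α → α ≤ 1 →
      ML ≤ (geoBY x).M →
        Ineq261 dB (toB6 (geoBY x) (R x) (H x)) δ α ∧
        (ScaleTransfer (geoBY x) δ α (((ℓ : ℝ) + 1) ^ 4) (fun s => (geoBY x).len s) ∧
          ScaleTransfer (geoBY x) δ α (((ℓ : ℝ) + 1) ^ 4) (fun s => (geoBY x).len s ^ 2) ∧
          ScaleTransfer (geoBY x) δ α (((ℓ : ℝ) + 1) ^ 4) (fun s => ((geoBY x).len s)⁻¹) ∧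
          ScaleTransfer (geoBY x) δ α (((ℓ : ℝ) + 1) ^ 4) (fun s => ((geoBY x).len s ^ 2)⁻¹) ∧
          ScaleTransfer (geoBY x) δ α (((ℓ : ℝ) + 1) ^ 4) (fun s => ((geoBY x).len s ^ 4)⁻¹) ∧
          ScaleTransfer (geoBY x) δ α (((ℓ : ℝ) + 1) ^ 4) (fun s => (geoBY x).len s ^ (-(4 : ℝ)))) := by
  have hκlo : 0 < αlo * δlo := mul_pos hαlo hδlo
  obtain ⟨dB, ML, h⟩ := ineq261_window_geoBY R H hδlo hδ hαlo
  refine ⟨dB, max ML (4 * Real.log ((ℓ : ℝ) + 1) / (αlo * δlo)), fun x δ α h1 h2 h3 h4 hM => ⟨?_, ?_⟩⟩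
  · exact h x δ α h1 h2 h3 h4 ((le_max_left _ _).trans hM)
  · have hκ : αlo * δlo ≤ α * δ := mul_le_mul h3 h1 hδlo.le (hαlo.le.trans h3)
    exact scaleTransfer6_window_geoBY hκlo x hκ ((le_max_right _ _).trans hM)

/-- ★★ **THE v2.1 FIELD `h261` OF THE SECT.-B FRAMES OVER `𝔅`** (αlo := 9∕5000, any cap `δcap`).
[cite: Balaban1984PropagatorsII, Lemma 2.1 (2.61) p.234 + (2.59) p.233] -/
theorem h261_frameV21_geoBY (Rr : MemberY d ℓ hd hL b₀ b₁ Mstar → ℝ) (Hp : MemberY d ℓ hd hL b₀ b₁ Mstar → Prop) (δcap : ℝ) :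
    ∃ (d261 : ℝ → ℕ) (M261 : ℝ → ℝ), ∀ (x : MemberY d ℓ hd hL b₀ b₁ Mstar) (δ α : ℝ), 0 < δ → δ ≤ δcap →
      9 / 5000 ≤ α → α < 1 → M261 δ ≤ (geoBY x).M → Ineq261 (d261 δ) (toB6 (geoBY x) (Rr x) (Hp x)) δ α := by
  obtain ⟨d261, M261, h⟩ := ineq261_fn_geoBY (d := d) (ℓ := ℓ) (hd := hd) (hL := hL) (b₀ := b₀) (b₁ := b₁)
    (Mstar := Mstar) Rr Hp (αlo := 9 / 5000) (by norm_num)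
  exact ⟨d261, M261, fun x δ α hδ _ hα hα1 hM => h x δ α hδ hα hα1.le hM⟩

omit [∀ x : MemberY d ℓ hd hL b₀ b₁ Mstar, Fintype (geoBY x).Site] in
/-- ★★ **THE v2.1 FIELD `hST` OF THE SECT.-B FRAMES OVER `𝔅`** (`Λf δ α := (ℓ+1)⁴`, `MST δ := 4·log(ℓ+1)∕((9∕5000)·δ)`).
[cite: Balaban1985BackgroundPropagators, p.398 remark after (3.47); Balaban1984PropagatorsII, Lemma 2.1 (2.60) p.234] -/
theorem hST_frameV21_geoBY (x : MemberY d ℓ hd hL b₀ b₁ Mstar) {δ α : ℝ} (hδ : 0 < δ) (hα : 9 / 5000 ≤ α)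
    (hM : 4 * Real.log ((ℓ : ℝ) + 1) / (9 / 5000 * δ) ≤ (geoBY x).M) :
    ScaleTransfer (geoBY x) δ α (((ℓ : ℝ) + 1) ^ 4) (fun s => (geoBY x).len s) ∧
      ScaleTransfer (geoBY x) δ α (((ℓ : ℝ) + 1) ^ 4) (fun s => (geoBY x).len s ^ 2) ∧
      ScaleTransfer (geoBY x) δ α (((ℓ : ℝ) + 1) ^ 4) (fun s => ((geoBY x).len s)⁻¹) ∧
      ScaleTransfer (geoBY x) δ α (((ℓ : ℝ) + 1) ^ 4) (fun s => ((geoBY x).len s ^ 2)⁻¹) ∧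
      ScaleTransfer (geoBY x) δ α (((ℓ : ℝ) + 1) ^ 4) (fun s => ((geoBY x).len s ^ 4)⁻¹) ∧
      ScaleTransfer (geoBY x) δ α (((ℓ : ℝ) + 1) ^ 4) (fun s => (geoBY x).len s ^ (-(4 : ℝ))) :=
  scaleTransfer6_window_geoBY (κlo := 9 / 5000 * δ) (by positivity) x (mul_le_mul_of_nonneg_right hα hδ.le) hM

end Members

end Literature.MathematicalPhysics.QuantumFieldTheory.Balaban1983to89.B9SectBAllBlocksGeometryY

end
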